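import Summits.ValiantsHypothesis.ValiantsHypothesis.Theorems.MonotoneRestorationOrbitRestorationQPDerivativeTowerAlt
import HarnessLib

/-!
# Graded alt-supported derivative systems are orbit-restorable (toward the ΣΛΣ sub-rung of A_∞), III

Route MonotoneRestoration, crux `OrbitRestorationQP` (stmt-ValiantsHypothesis-18293), line `depth-three-rung`,
stub A_∞ `stub_sigmaPiSigmaValue`.  Namespace `Summit.ValiantsHypothesis.ValiantsHypothesis.Theorems.DerivativeTowerAlt`.

`…DerivativeTowerAlt.lean` needs ONE tower with a homogeneous top `f ∈ T 0`.  For NON-homogeneous `f` (powers of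
AFFINE forms, mixed degrees) the natural datum is a system of finite value sets `V e` GRADED BY DEGREE: every
`t ∈ V e` homogeneous of degree `e` and alt-supported on `≤ k` indices, `∂_x (V (e+1)) ⊆ span (V e)`, and `f`
merely a LINEAR COMBINATION of values of degree `≤ D`.  The same Euler/value-derivation mechanism applies (one
extra sum step for `f`):

* `qpOrbitRestorable_of_gradedSystem` — **a diagonally invariant `f ∈ span (⋃_{e ≤ D} V e)` of a graded
  alt-supported derivative system is `QPOrbitRestorable (k + 7) n f`.**

Everything is proved. [folklore]
-/

noncomputable section

open scoped Classical

-- `Summit.ValiantsHypothesis.ValiantsHypothesis.…` is the tree's single-conjunct layout (Sub = Summit).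
set_option linter.dupNamespace false

namespace Summit.ValiantsHypothesis.ValiantsHypothesis.Theorems

namespace DerivativeTowerAlt

open MvPolynomial Finset Equiv OrbitRestorationQPDepthThreeRung

variable {n : ℕ}

/-- **GRADED ALT-SUPPORTED DERIVATIVE SYSTEMS ARE ORBIT-RESTORABLE.**  Let `V 0, V 1, …` be finite sets of
polynomials on the `n × n` matrix with every `t ∈ V e` homogeneous of degree `e` and fixed by all even
permutations fixing pointwise some `≤ k` indices, and with `∂_x t ∈ span (V e)` for `t ∈ V (e+1)`.  Then every
diagonally `Sym(Fin n)`-invariant `f` in the span of `⋃_{e ≤ D} V e` is `QPOrbitRestorable (k + 7) n f`.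
[folklore] -/
theorem qpOrbitRestorable_of_gradedSystem {k D : ℕ} (V : ℕ → Finset (MvPolynomial (Fin n × Fin n) ℂ))
    (hhom : ∀ e, ∀ t ∈ V e, t.IsHomogeneous e)
    (hsupp : ∀ e, ∀ t ∈ V e, ∃ Y : Finset (Fin n), Y.card ≤ k ∧
      ∀ ρ : Perm (Fin n), (∀ i ∈ Y, ρ i = i) → Perm.sign ρ = 1 → ren ρ t = t)
    (hder : ∀ e, ∀ t ∈ V (e + 1), ∀ x : Fin n × Fin n,
      pderiv x t ∈ Submodule.span ℂ (V e : Set (MvPolynomial (Fin n × Fin n) ℂ)))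
    {f : MvPolynomial (Fin n × Fin n) ℂ}
    (hf : f ∈ Submodule.span ℂ (((Finset.range (D + 1)).biUnion V : Finset _) : Set (MvPolynomial (Fin n × Fin n) ℂ)))
    (hfix : ∀ σ : Perm (Fin n), ren σ f = f) :
    QPOrbitRestorable (k + 7) n f := by
  -- the values
  set Vars : Finset (MvPolynomial (Fin n × Fin n) ℂ) :=
    (Finset.univ : Finset (Fin n × Fin n)).image fun x => MvPolynomial.X x with hVars
  set Vall : Finset (MvPolynomial (Fin n × Fin n) ℂ) := (Finset.range (D + 1)).biUnion V with hVall
  set Mall : Finset (MvPolynomial (Fin n × Fin n) ℂ) := (Finset.range D).biUnion fun e =>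
    ((Finset.univ : Finset (Fin n × Fin n)) ×ˢ V e).image fun p => MvPolynomial.X p.1 * p.2 with hMall
  set S : Finset (MvPolynomial (Fin n × Fin n) ℂ) := Vars ∪ Vall ∪ Mall ∪ {f} with hS
  -- the rank
  let rank : MvPolynomial (Fin n × Fin n) ℂ → ℕ := fun q =>
    if q.totalDegree = 0 then 0 else if q ∈ Vars then 0 else
      if q ∈ Mall then 2 * q.totalDegree - 1 else if q ∈ Vall then 2 * q.totalDegree else 2 * D + 2
  have hdegV : ∀ e, ∀ t ∈ V e, t ≠ 0 → t.totalDegree = e := fun e t ht h0 => (hhom e t ht).totalDegree h0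
  have hdegM : ∀ e, ∀ t ∈ V e, ∀ x : Fin n × Fin n, MvPolynomial.X x * t ≠ 0 →
      (MvPolynomial.X x * t).totalDegree = e + 1 := by
    intro e t ht x h0
    have ht0 : t ≠ 0 := fun h => h0 (by rw [h, mul_zero])
    rw [totalDegree_mul_of_isDomain (X_ne_zero x) ht0, totalDegree_X, hdegV _ t ht ht0, add_comm]
  -- membership helpers
  have hXS : ∀ x, MvPolynomial.X x ∈ S := fun x =>
    Finset.mem_union_left _ (Finset.mem_union_left _ (Finset.mem_union_left _
      (Finset.mem_image.2 ⟨x, Finset.mem_univ _, rfl⟩)))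
  have hVmem : ∀ e, e ≤ D → ∀ t ∈ V e, t ∈ Vall := fun e he t ht =>
    Finset.mem_biUnion.2 ⟨e, Finset.mem_range.2 (Nat.lt_succ_of_le he), ht⟩
  have hVS : ∀ e, e ≤ D → ∀ t ∈ V e, t ∈ S := fun e he t ht =>
    Finset.mem_union_left _ (Finset.mem_union_left _ (Finset.mem_union_right _ (hVmem e he t ht)))
  have hMmem : ∀ e, e < D → ∀ t ∈ V e, ∀ x : Fin n × Fin n, MvPolynomial.X x * t ∈ Mall :=
    fun e he t ht x => Finset.mem_biUnion.2 ⟨e, Finset.mem_range.2 he,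
      Finset.mem_image.2 ⟨(x, t), Finset.mem_product.2 ⟨Finset.mem_univ _, ht⟩, rfl⟩⟩
  have hMS : ∀ q ∈ Mall, q ∈ S := fun q hq => Finset.mem_union_left _ (Finset.mem_union_right _ hq)
  have hrank_leV : ∀ q ∈ Vall, rank q ≤ 2 * q.totalDegree := by
    intro q hq
    simp only [rank]
    split_ifs <;> omega
  have hrankX : ∀ x, rank (MvPolynomial.X x) = 0 := by
    intro x
    have hx : MvPolynomial.X x ∈ Vars := Finset.mem_image.2 ⟨x, Finset.mem_univ _, rfl⟩
    simp only [rank, if_pos hx]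
    split_ifs <;> rfl
  have hrankM : ∀ e, e < D → ∀ t ∈ V e, ∀ x : Fin n × Fin n,
      rank (MvPolynomial.X x * t) < 2 * (e + 1) := by
    intro e he t ht x
    have hm : MvPolynomial.X x * t ∈ Mall := hMmem e he t ht x
    simp only [rank, if_pos hm]
    split_ifs with h1 h2
    · omega
    · omega
    · have h0 : MvPolynomial.X x * t ≠ 0 := fun h => h1 (by rw [h, totalDegree_zero])
      rw [hdegM e t ht x h0]; omega
  -- degrees inside `Vall` are `≤ D`
  have hdegVall : ∀ q ∈ Vall, q.totalDegree ≤ D := by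
    intro q hq
    obtain ⟨e, he, hqe⟩ := Finset.mem_biUnion.mp hq
    rw [Finset.mem_range] at he
    by_cases h0 : q = 0
    · rw [h0, totalDegree_zero]; exact Nat.zero_le _
    · rw [hdegV e q hqe h0]; omega
  -- the steps
  have hstep : ∀ q ∈ S, ∃ st : StepData ℂ (Fin n × Fin n), st.Valid S rank q := by
    intro q hq
    by_cases h0 : q.totalDegree = 0
    · refine ⟨StepData.const (coeff 0 q), ⟨(totalDegree_eq_zero_iff_eq_C.mp h0).symm, fun u hu => ?_⟩⟩
      simp [StepData.args] at hu
    by_cases hV : q ∈ Vars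
    · obtain ⟨x, -, rfl⟩ := Finset.mem_image.mp hV
      exact ⟨StepData.var x, ⟨rfl, fun u hu => by simp [StepData.args] at hu⟩⟩
    have hq0 : q ≠ 0 := fun h => h0 (by rw [h, totalDegree_zero])
    by_cases hM : q ∈ Mall
    · -- product step
      have hrq : rank q = 2 * q.totalDegree - 1 := by simp only [rank, if_neg h0, if_neg hV, if_pos hM]
      obtain ⟨e, he, hq'⟩ := Finset.mem_biUnion.mp hM
      rw [Finset.mem_range] at he
      obtain ⟨p, hp, hpq⟩ := Finset.mem_image.mp hq'
      have ht : p.2 ∈ V e := (Finset.mem_product.mp hp).2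
      have hq0' : MvPolynomial.X p.1 * p.2 ≠ 0 := by rw [hpq]; exact hq0
      have ht0 : p.2 ≠ 0 := fun h => hq0' (by rw [h, mul_zero])
      have hdq : q.totalDegree = e + 1 := by rw [← hpq]; exact hdegM e _ ht _ hq0'
      refine ⟨StepData.prod (MvPolynomial.X p.1) p.2, ⟨hpq, fun u hu => ?_⟩⟩
      simp only [StepData.args, Multiset.insert_eq_cons, Multiset.mem_cons, Multiset.mem_singleton] at hu
      rcases hu with rfl | rfl
      · exact ⟨hXS _, by rw [hrankX, hrq, hdq]; omega⟩
      · refine ⟨hVS e (by omega) _ ht, ?_⟩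
        have := hrank_leV p.2 (hVmem e (by omega) _ ht)
        rw [hdegV _ _ ht ht0] at this
        rw [hrq, hdq]; omega
    by_cases hT : q ∈ Vall
    · -- Euler step: `q ∈ V e`
      have hrq : rank q = 2 * q.totalDegree := by
        simp only [rank, if_neg h0, if_neg hV, if_neg hM, if_pos hT]
      obtain ⟨e, he, hqe⟩ := Finset.mem_biUnion.mp hT
      rw [Finset.mem_range] at he
      have hqh : q.IsHomogeneous e := hhom e q hqe
      have hdq : q.totalDegree = e := hqh.totalDegree hq0
      have he1 : 1 ≤ e := by omega
      obtain ⟨e', rfl⟩ : ∃ e', e = e' + 1 := ⟨e - 1, by omega⟩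
      have hcoef : ∀ x : Fin n × Fin n, ∃ c : MvPolynomial (Fin n × Fin n) ℂ → ℂ,
          ∑ t ∈ V e', c t • t = pderiv x q := fun x => by
        obtain ⟨c, -, hc⟩ := Submodule.mem_span_finset.mp (hder e' q hqe x)
        exact ⟨c, hc⟩
      choose c hc using hcoef
      have he0 : ((e' + 1 : ℕ) : ℂ) ≠ 0 := by exact_mod_cast (Nat.succ_ne_zero e')
      let Dm : Multiset (ℂ × MvPolynomial (Fin n × Fin n) ℂ) :=
        (((Finset.univ : Finset (Fin n × Fin n)) ×ˢ V e').val).map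
          fun p => (((e' + 1 : ℕ) : ℂ)⁻¹ * c p.1 p.2, MvPolynomial.X p.1 * p.2)
      refine ⟨StepData.sum Dm, ⟨?_, fun u hu => ?_⟩⟩
      · show (Dm.map fun cu => C cu.1 * cu.2).sum = q
        rw [Multiset.map_map]
        have hsum : (Multiset.map ((fun cu : ℂ × MvPolynomial (Fin n × Fin n) ℂ => C cu.1 * cu.2) ∘
            fun p : (Fin n × Fin n) × MvPolynomial (Fin n × Fin n) ℂ =>
              ((((e' + 1 : ℕ) : ℂ))⁻¹ * c p.1 p.2, MvPolynomial.X p.1 * p.2))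
            (((Finset.univ : Finset (Fin n × Fin n)) ×ˢ V e').val)).sum =
            ∑ p ∈ (Finset.univ : Finset (Fin n × Fin n)) ×ˢ V e',
              C ((((e' + 1 : ℕ) : ℂ))⁻¹ * c p.1 p.2) * (MvPolynomial.X p.1 * p.2) :=
          (Finset.sum_eq_multiset_sum _ _).symm
        rw [hsum, Finset.sum_product]
        have h1 : ∀ x : Fin n × Fin n, ∑ t ∈ V e', C ((((e' + 1 : ℕ) : ℂ))⁻¹ * c x t) * (MvPolynomial.X x * t) =
            C (((e' + 1 : ℕ) : ℂ))⁻¹ * (MvPolynomial.X x * pderiv x q) := by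
          intro x
          rw [← hc x, Finset.mul_sum, Finset.mul_sum]
          refine Finset.sum_congr rfl fun t _ => ?_
          rw [smul_eq_C_mul, map_mul]
          ring
        rw [Finset.sum_congr rfl fun x _ => h1 x, ← Finset.mul_sum, hqh.sum_X_mul_pderiv, nsmul_eq_mul,
          ← mul_assoc, ← map_natCast (C : ℂ →+* MvPolynomial (Fin n × Fin n) ℂ), ← map_mul,
          inv_mul_cancel₀ he0, map_one, one_mul]
      · simp only [StepData.args, Dm, Multiset.map_map, Function.comp_def, Multiset.mem_map, Finset.mem_val,
          Finset.mem_product, Finset.mem_univ, true_and] at hu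
        obtain ⟨p, hp, rfl⟩ := hu
        refine ⟨hMS _ (hMmem e' (by omega) _ hp _), ?_⟩
        rw [hrq, hdq]
        exact hrankM e' (by omega) _ hp _
    · -- the final sum step: `q = f`, a combination of values of degree `≤ D`
      have hqf : q = f := by
        rcases Finset.mem_union.mp hq with hq | hq
        · rcases Finset.mem_union.mp hq with hq | hq
          · rcases Finset.mem_union.mp hq with hq | hq
            · exact absurd hq hV
            · exact absurd hq hT
          · exact absurd hq hM
        · exact Finset.mem_singleton.mp hq
      have hrq : rank q = 2 * D + 2 := by
        simp only [rank, if_neg h0, if_neg hV, if_neg hM, if_neg hT]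
      obtain ⟨c, -, hc⟩ := Submodule.mem_span_finset.mp hf
      let Df : Multiset (ℂ × MvPolynomial (Fin n × Fin n) ℂ) := Vall.val.map fun t => (c t, t)
      refine ⟨StepData.sum Df, ⟨?_, fun u hu => ?_⟩⟩
      · show (Df.map fun cu => C cu.1 * cu.2).sum = q
        rw [hqf, Multiset.map_map, ← hc]
        have : (Multiset.map ((fun cu : ℂ × MvPolynomial (Fin n × Fin n) ℂ => C cu.1 * cu.2) ∘
            fun t => (c t, t)) Vall.val).sum = ∑ t ∈ Vall, C (c t) * t := (Finset.sum_eq_multiset_sum _ _).symm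
        rw [this]
        exact Finset.sum_congr rfl fun t _ => (smul_eq_C_mul _ _).symm
      · simp only [StepData.args, Df, Multiset.map_map, Function.comp_def, Multiset.mem_map, Finset.mem_val] at hu
        obtain ⟨t, ht, rfl⟩ := hu
        refine ⟨Finset.mem_union_left _ (Finset.mem_union_left _ (Finset.mem_union_right _ ht)), ?_⟩
        rw [hrq]
        have h1 := hrank_leV t ht
        have h2 := hdegVall t ht
        omega
  -- the derivation and the orbit bounds
  let 𝒟 : ValueDerivation ℂ (Fin n × Fin n) := ⟨S, rank, hstep⟩
  have hfS : f ∈ 𝒟.S := Finset.mem_union_right _ (Finset.mem_singleton_self f)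
  have horb : ∀ q ∈ 𝒟.S, (Set.range fun σ : Perm (Fin n) => ren σ q).ncard ≤
      2 ^ ((Nat.log 2 n + (k + 4)) ^ (k + 4)) := by
    intro q hq
    refine le_trans ?_ (pow_le_qp n k)
    rcases Finset.mem_union.mp hq with hq | hq
    · rcases Finset.mem_union.mp hq with hq | hq
      · rcases Finset.mem_union.mp hq with hq | hq
        · obtain ⟨x, -, rfl⟩ := Finset.mem_image.mp hq
          exact ncard_orbit_X_le k x
        · obtain ⟨e, -, hqe⟩ := Finset.mem_biUnion.mp hq
          obtain ⟨Y, hYk, hY⟩ := hsupp e q hqe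
          exact ncard_orbit_le_of_altSupported hYk hY
      · obtain ⟨e, -, hq'⟩ := Finset.mem_biUnion.mp hq
        obtain ⟨p, hp, rfl⟩ := Finset.mem_image.mp hq'
        obtain ⟨Y, hYk, hY⟩ := hsupp e p.2 (Finset.mem_product.mp hp).2
        exact ncard_orbit_X_mul_le hYk hY p.1
    · rw [Finset.mem_singleton.mp hq]
      rw [show (Set.range fun σ : Perm (Fin n) => ren σ f) = {f} from ?_]
      · rw [Set.ncard_singleton]
        exact Nat.mul_le_mul (by norm_num : 1 ≤ 2) (Nat.one_le_pow _ _ (Nat.succ_pos n))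
      · ext q; simp only [Set.mem_range, hfix, Set.mem_singleton_iff, exists_const, eq_comm]
  obtain ⟨G, inst, C, hC, hev, hOrb⟩ := ValueOrbit.qpOrbit_of_valueDerivation (c := k + 4) 𝒟 hfS hfix horb
  exact ⟨G, inst, C, hC, hev, hOrb⟩

end DerivativeTowerAlt

end Summit.ValiantsHypothesis.ValiantsHypothesis.Theorems

end
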